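import Mathlib
import Summits.NavierStokesRegularity.NavierStokesRegularity.Theorems.TaoLadderRungTwoFlatCoreContractZ
import HarnessLib

/-!
# CORE CONTRACT 64, part 2/2 (the contract with a reference FAMILY and sharp rows; the wake row; the split core step)
  (theory-1 g49 CoreContractZ64.lean 2ad286597d671f9f, second half, byte-identical below the imports; see part 1
  `…CoreContractZ` for the design note; helper for the K_A♭ parent item stmt-NavierStokesRegularity-22987, route TaoLadderRungTwoFlat;
  cell harvest/h2-tao-ladder, LADDER §64.2 (TRAP #24), §64.8–64.11 (TRAP #25), referee W-28)

* `CoreLandingFromZ`, `CoreLandingWindowZ` — the sharp contract (rows `k ≥ 1−K`) with the reference family `W z`;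
* `coreLandingFromZ_of_window_tail` — window + (T1) tail + head bound + pulse tail ⇒ sharp contract;
* `coreClauseFrom_landing_of_contract` — SHARP landing at good times (row `B ≤ AFL·δs(n+1)`);
* `wakeRow_of_levels` — the `k = −K` row from the interface level + the reference wake residual `RW` + row `hwake`;
* `tubeStepCoreWith_of_split` — sharp landing + wake row + `δs ≤ P.δ` ⇒ `TubeStepCoreWith` (weak schedule) for the choice rule;
* `coreClauseFrom_of_splitBcl`.

HONEST FRAMING: pure logic/bookkeeping over the cell's typed frame (MODEL lattice); the landing contract, the interface levels, the
reference wake residual and every scalar schedule row are HYPOTHESES; nothing certified; no item closed; nothing about the Navier–Stokes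
equations.
-/

noncomputable section

-- the sub-problem namespace repeats the summit name by design (D-0017)
set_option linter.dupNamespace false

namespace Summit.NavierStokesRegularity.NavierStokesRegularity.Theorems.HopTube

open Set Finset Literature.Analysis.FluidPDE Literature.Analysis.FluidPDE.TaoCascade MirrorPulse

/-! ## The contract with a reference FAMILY and sharp rows -/

section ContractZ

variable (P : TubeSchedule) (Bcl : ℕ → (Fin 2 → ℤ → ℝ) → Prop) (𝕊 : Finset (ℤ × ℤ × ℤ)) (ε₀ : ℝ) (i₀ : Fin 2)
  (α : Fin 2 → Fin 2 → Fin 2 → ℤ × ℤ × ℤ → ℝ) (X₀ : Fin 2 → ℝ) (w : ℤ → ℝ) (r c₀ : ℝ)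
  (ζ : ℕ → Fin 2 → ℤ → ℝ) (ustar : Fin 2 → ℤ → ℝ) (good : ℕ → (Fin 2 → ℤ → ℝ → ℝ) → ℝ → Prop)
  (W : (Fin 2 → ℤ → ℝ) → Fin 2 → ℤ → ℝ → ℝ)

/-- **THE SHARP CORE LANDING CONTRACT at hop `n`, reference family `W z`**: for every premise flow `S` of hop `n` started at the tube
state `z` and every good section time `t`, if the interface-shell deviation from `W z` stays under `lev i` on `[0, t]`, the anchored
deviation at `t` is at most `B` in the `(g,b)` gauge on the sharp rows `k ≥ 1−K`.
[cite: Tao2016AveragedNS, §6.3–6.4 (statement shape); cell LADDER §62 (P-62a), §64 (TRAP #24/#25), referee W-28] -/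
def CoreLandingFromZ (n : ℕ) (lev : Fin 2 → ℝ) (B : ℝ) : Prop :=
  ∀ z S₀ τ S F, HopPremiseWith P Bcl 𝕊 ε₀ i₀ α X₀ w r c₀ ζ ustar n z S₀ τ S F → ∀ t, good n S t →
    (∀ s ∈ Icc 0 t, ∀ i, |(S - W z) i (1 - (P.K : ℤ)) s| ≤ lev i) →
      ∀ (i : Fin 2) (k : ℤ), 1 - (P.K : ℤ) ≤ k →
        geomGauge P.g P.b i k * |anchoredDev P i₀ ustar S t i k| ≤ B

/-- The same restricted to the finite window `1−K ≤ k ≤ k_A` (what the interval engine encloses: numT64 rows `k′ ∈ [1−K, k_A]`).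
[cite: Tao2016AveragedNS, §6.3–6.4 (statement shape); cell LADDER §62, §64 (engine-0 window), referee A-115] -/
def CoreLandingWindowZ (n : ℕ) (lev : Fin 2 → ℝ) (B : ℝ) (kA : ℤ) : Prop :=
  ∀ z S₀ τ S F, HopPremiseWith P Bcl 𝕊 ε₀ i₀ α X₀ w r c₀ ζ ustar n z S₀ τ S F → ∀ t, good n S t →
    (∀ s ∈ Icc 0 t, ∀ i, |(S - W z) i (1 - (P.K : ℤ)) s| ≤ lev i) →
      ∀ (i : Fin 2) (k : ℤ), 1 - (P.K : ℤ) ≤ k → k ≤ kA →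
        geomGauge P.g P.b i k * |anchoredDev P i₀ ustar S t i k| ≤ B

end ContractZ

section StepZ

variable {P : TubeSchedule} {Bcl : ℕ → (Fin 2 → ℤ → ℝ) → Prop} {𝕊 : Finset (ℤ × ℤ × ℤ)} {ε₀ : ℝ} {i₀ : Fin 2}
  {α : Fin 2 → Fin 2 → Fin 2 → ℤ × ℤ × ℤ → ℝ} {X₀ : Fin 2 → ℝ} {w : ℤ → ℝ} {r θ₀ c₀ t₀ : ℝ}
  {ζ : ℕ → Fin 2 → ℤ → ℝ} {ustar : Fin 2 → ℤ → ℝ} {good : ℕ → (Fin 2 → ℤ → ℝ → ℝ) → ℝ → Prop} {n : ℕ}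
  {W : (Fin 2 → ℤ → ℝ) → Fin 2 → ℤ → ℝ → ℝ}

/-- **WINDOW + TAIL ⇒ SHARP CONTRACT** (the finite-window reduction, reference family): as `coreLandingWith_of_window_tail`.
[cite: Tao2016AveragedNS, §6.3–6.4 (statement shape); cell LADDER §62, referee A-115 (ii)] -/
theorem coreLandingFromZ_of_window_tail {lev : Fin 2 → ℝ} {Bw B BT MH UT : ℝ} {kA : ℤ}
    (hg : 0 < P.g) (hb : 0 < P.b) (hA : 0 < P.Astar)
    (hwin : CoreLandingWindowZ P Bcl 𝕊 ε₀ i₀ α X₀ w r c₀ ζ ustar good W n lev Bw kA)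
    (htail : AheadTailWith P Bcl 𝕊 ε₀ i₀ α X₀ w r c₀ ζ ustar good n kA BT)
    (hhead : ∀ z S₀ τ S F, HopPremiseWith P Bcl 𝕊 ε₀ i₀ α X₀ w r c₀ ζ ustar n z S₀ τ S F → ∀ t, good n S t →
      |S i₀ 1 t| ≤ MH)
    (hU : ∀ (i : Fin 2) (k : ℤ), kA < k → geomGauge P.g P.b i k * |ustar i k| ≤ UT)
    (hBw : Bw ≤ B) (hBT : BT + MH / P.Astar * UT ≤ B) :
    CoreLandingFromZ P Bcl 𝕊 ε₀ i₀ α X₀ w r c₀ ζ ustar good W n lev B := by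
  intro z S₀ τ S F hprem t ht hlev i k hk
  rcases le_or_gt k kA with hkA | hkA
  · exact (hwin z S₀ τ S F hprem t ht hlev i k hk hkA).trans hBw
  · have hω : 0 ≤ geomGauge P.g P.b i k := (geomGauge_pos hg hb i k).le
    have h1 : geomGauge P.g P.b i k * |S i (1 + k) t| ≤ BT := htail z S₀ τ S F hprem t ht i k hkA
    have h2 : geomGauge P.g P.b i k * |ustar i k| ≤ UT := hU i k hkA
    have hMH : 0 ≤ MH := (abs_nonneg _).trans (hhead z S₀ τ S F hprem t ht)
    have h3 : |S i₀ 1 t| / P.Astar ≤ MH / P.Astar :=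
      div_le_div_of_nonneg_right (hhead z S₀ τ S F hprem t ht) hA.le
    have h4 : 0 ≤ |S i₀ 1 t| / P.Astar := div_nonneg (abs_nonneg _) hA.le
    have htri : |anchoredDev P i₀ ustar S t i k| ≤ |S i (1 + k) t| + |S i₀ 1 t| / P.Astar * |ustar i k| := by
      unfold anchoredDev
      calc |S i (1 + k) t - |S i₀ 1 t| / P.Astar * ustar i k|
          ≤ |S i (1 + k) t| + |(|S i₀ 1 t| / P.Astar) * ustar i k| := abs_sub _ _
        _ = |S i (1 + k) t| + |S i₀ 1 t| / P.Astar * |ustar i k| := by rw [abs_mul, abs_of_nonneg h4]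
    calc geomGauge P.g P.b i k * |anchoredDev P i₀ ustar S t i k|
        ≤ geomGauge P.g P.b i k * (|S i (1 + k) t| + |S i₀ 1 t| / P.Astar * |ustar i k|) :=
          mul_le_mul_of_nonneg_left htri hω
      _ = geomGauge P.g P.b i k * |S i (1 + k) t| + |S i₀ 1 t| / P.Astar * (geomGauge P.g P.b i k * |ustar i k|) := by
          ring
      _ ≤ BT + MH / P.Astar * UT :=
          add_le_add h1 (mul_le_mul h3 h2 (mul_nonneg hω (abs_nonneg _)) (div_nonneg hMH hA.le))
      _ ≤ B := hBT

/-- **SHARP CONTRACT ⇒ SHARP LANDING at good times** (the `CoreClauseFrom` half of `splitBcl (n+1)` for the re-centred state):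
contract + interface levels + ratio floor `AFL` + the schedule row `B ≤ AFL·δs(n+1)`.
[cite: Tao2016AveragedNS, §6.4 (statement shape of the checkpoint step); cell LADDER §62 (P-62a), §64.2 (P-64a)] -/
theorem coreClauseFrom_landing_of_contract {lev : Fin 2 → ℝ} {B AFL : ℝ} {δs : ℕ → ℝ}
    (hland : CoreLandingFromZ P Bcl 𝕊 ε₀ i₀ α X₀ w r c₀ ζ ustar good W n lev B)
    (hlev : ∀ z S₀ τ S F, HopPremiseWith P Bcl 𝕊 ε₀ i₀ α X₀ w r c₀ ζ ustar n z S₀ τ S F → ∀ t, good n S t →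
      ∀ s ∈ Icc 0 t, ∀ i, |(S - W z) i (1 - (P.K : ℤ)) s| ≤ lev i)
    (hAFL : 0 < AFL)
    (hratio : ∀ z S₀ τ S F, HopPremiseWith P Bcl 𝕊 ε₀ i₀ α X₀ w r c₀ ζ ustar n z S₀ τ S F → ∀ t, good n S t →
      AFL ≤ clampedRatio P i₀ ε₀ θ₀ t S)
    (hδ : 0 ≤ δs (n + 1)) (hsched : B ≤ AFL * δs (n + 1)) :
    ∀ z S₀ τ S F, HopPremiseWith P Bcl 𝕊 ε₀ i₀ α X₀ w r c₀ ζ ustar n z S₀ τ S F → ∀ t, good n S t →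
      CoreClauseFrom P δs i₀ ustar (n + 1) (recentre S t (clampedRatio P i₀ ε₀ θ₀ t S)) := by
  intro z S₀ τ S F hprem t ht i k hk
  have ha : 0 < clampedRatio P i₀ ε₀ θ₀ t S := lt_of_lt_of_le hAFL (hratio z S₀ τ S F hprem t ht)
  have hB : geomGauge P.g P.b i k * |anchoredDev P i₀ ustar S t i k| ≤ B :=
    hland z S₀ τ S F hprem t ht (hlev z S₀ τ S F hprem t ht) i k hk
  have hBa : B ≤ clampedRatio P i₀ ε₀ θ₀ t S * δs (n + 1) :=
    hsched.trans (mul_le_mul_of_nonneg_right (hratio z S₀ τ S F hprem t ht) hδ)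
  rw [coreDev_recentre P i₀ ustar S ha, abs_div, abs_of_pos ha, ← mul_div_assoc, div_le_iff₀ ha]
  calc geomGauge P.g P.b i k * |anchoredDev P i₀ ustar S t i k| ≤ B := hB
    _ ≤ clampedRatio P i₀ ε₀ θ₀ t S * δs (n + 1) := hBa
    _ = δs (n + 1) * clampedRatio P i₀ ε₀ θ₀ t S := mul_comm _ _

/-- **THE WAKE ROW** (TRAP #24): at a good time `t` the anchored deviation at `k = −K` is the interface deviation from the reference
(level `lev i` at time `t`) plus the reference's own wake residual against the selected template (`RW`, a reference-only E2 row);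
with the ratio floor and the schedule row `ω_{−K}·(lev i + RW) ≤ AFL·P.δ(n+1)` the re-centred state satisfies the uniform clause's
row `k = −K` with radius `P.δ (n+1)` (intended `P := wakeSchedule P₀ aK`, i.e. radius `aK(n+1) = AKD(n+1)`).
[cite: Tao2016AveragedNS, §6.3–6.4 (statement shape); cell LADDER §64.2 (TRAP #24: wake row from the interface loop)] -/
theorem wakeRow_of_levels {lev : Fin 2 → ℝ} {RW AFL : ℝ}
    (hg : 0 < P.g) (hb : 0 < P.b)
    (hlev : ∀ z S₀ τ S F, HopPremiseWith P Bcl 𝕊 ε₀ i₀ α X₀ w r c₀ ζ ustar n z S₀ τ S F → ∀ t, good n S t →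
      ∀ s ∈ Icc 0 t, ∀ i, |(S - W z) i (1 - (P.K : ℤ)) s| ≤ lev i)
    (ht0 : ∀ z S₀ τ S F, HopPremiseWith P Bcl 𝕊 ε₀ i₀ α X₀ w r c₀ ζ ustar n z S₀ τ S F → ∀ t, good n S t → 0 ≤ t)
    (hRW : ∀ z S₀ τ S F, HopPremiseWith P Bcl 𝕊 ε₀ i₀ α X₀ w r c₀ ζ ustar n z S₀ τ S F → ∀ t, good n S t →
      ∀ i, |W z i (1 - (P.K : ℤ)) t - |S i₀ 1 t| / P.Astar * ustar i (-(P.K : ℤ))| ≤ RW)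
    (hAFL : 0 < AFL)
    (hratio : ∀ z S₀ τ S F, HopPremiseWith P Bcl 𝕊 ε₀ i₀ α X₀ w r c₀ ζ ustar n z S₀ τ S F → ∀ t, good n S t →
      AFL ≤ clampedRatio P i₀ ε₀ θ₀ t S)
    (hδ : 0 ≤ P.δ (n + 1))
    (hwake : ∀ i, geomGauge P.g P.b i (-(P.K : ℤ)) * (lev i + RW) ≤ AFL * P.δ (n + 1)) :
    ∀ z S₀ τ S F, HopPremiseWith P Bcl 𝕊 ε₀ i₀ α X₀ w r c₀ ζ ustar n z S₀ τ S F → ∀ t, good n S t →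
      ∀ i : Fin 2, geomGauge P.g P.b i (-(P.K : ℤ)) *
        |recentre S t (clampedRatio P i₀ ε₀ θ₀ t S) i (-(P.K : ℤ)) -
          anchorScale P i₀ (recentre S t (clampedRatio P i₀ ε₀ θ₀ t S)) * ustar i (-(P.K : ℤ))| ≤ P.δ (n + 1) := by
  intro z S₀ τ S F hprem t ht i
  have ha : 0 < clampedRatio P i₀ ε₀ θ₀ t S := lt_of_lt_of_le hAFL (hratio z S₀ τ S F hprem t ht)
  have hω : 0 ≤ geomGauge P.g P.b i (-(P.K : ℤ)) := (geomGauge_pos hg hb i _).le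
  have hlevt : |(S - W z) i (1 - (P.K : ℤ)) t| ≤ lev i :=
    hlev z S₀ τ S F hprem t ht t ⟨ht0 z S₀ τ S F hprem t ht, le_rfl⟩ i
  have hRWt := hRW z S₀ τ S F hprem t ht i
  -- the anchored deviation at the wake row splits into (S − W z) at the interface shell + the reference's wake residual
  have hsplit : anchoredDev P i₀ ustar S t i (-(P.K : ℤ)) =
      (S - W z) i (1 - (P.K : ℤ)) t + (W z i (1 - (P.K : ℤ)) t - |S i₀ 1 t| / P.Astar * ustar i (-(P.K : ℤ))) := by
    have hidx : (1 : ℤ) + -(P.K : ℤ) = 1 - (P.K : ℤ) := by ring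
    unfold anchoredDev
    rw [hidx, Pi.sub_apply, Pi.sub_apply, Pi.sub_apply]
    ring
  have hdev : |anchoredDev P i₀ ustar S t i (-(P.K : ℤ))| ≤ lev i + RW := by
    rw [hsplit]
    exact (abs_add_le _ _).trans (add_le_add hlevt hRWt)
  have hB : geomGauge P.g P.b i (-(P.K : ℤ)) * |anchoredDev P i₀ ustar S t i (-(P.K : ℤ))| ≤ AFL * P.δ (n + 1) :=
    (mul_le_mul_of_nonneg_left hdev hω).trans (hwake i)
  have hBa : AFL * P.δ (n + 1) ≤ clampedRatio P i₀ ε₀ θ₀ t S * P.δ (n + 1) :=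
    mul_le_mul_of_nonneg_right (hratio z S₀ τ S F hprem t ht) hδ
  rw [coreDev_recentre P i₀ ustar S ha, abs_div, abs_of_pos ha, ← mul_div_assoc, div_le_iff₀ ha]
  calc geomGauge P.g P.b i (-(P.K : ℤ)) * |anchoredDev P i₀ ustar S t i (-(P.K : ℤ))| ≤ AFL * P.δ (n + 1) := hB
    _ ≤ clampedRatio P i₀ ε₀ θ₀ t S * P.δ (n + 1) := hBa
    _ = P.δ (n + 1) * clampedRatio P i₀ ε₀ θ₀ t S := mul_comm _ _

/-- **SPLIT LANDING ⇒ THE UNIFORM CORE OBLIGATION of the (weak-schedule) tube for the choice rule**: the sharp landing at good times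
(`coreClauseFrom_landing_of_contract`), the wake row at good times (`wakeRow_of_levels`) and `δs(n+1) ≤ P.δ(n+1)` give `TubeStepCoreWith`.
[cite: Tao2016AveragedNS, §6.3–6.4 (statement shape of the checkpoint step); cell LADDER §64.2 (P-64a), referee W-28] -/
theorem tubeStepCoreWith_of_split {δs : ℕ → ℝ}
    (hex : ∀ z S₀ τ S F, HopPremiseWith P Bcl 𝕊 ε₀ i₀ α X₀ w r c₀ ζ ustar n z S₀ τ S F → ∃ t, good n S t)
    (hfrom : ∀ z S₀ τ S F, HopPremiseWith P Bcl 𝕊 ε₀ i₀ α X₀ w r c₀ ζ ustar n z S₀ τ S F → ∀ t, good n S t →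
      CoreClauseFrom P δs i₀ ustar (n + 1) (recentre S t (clampedRatio P i₀ ε₀ θ₀ t S)))
    (hrow : ∀ z S₀ τ S F, HopPremiseWith P Bcl 𝕊 ε₀ i₀ α X₀ w r c₀ ζ ustar n z S₀ τ S F → ∀ t, good n S t →
      ∀ i : Fin 2, geomGauge P.g P.b i (-(P.K : ℤ)) *
        |recentre S t (clampedRatio P i₀ ε₀ θ₀ t S) i (-(P.K : ℤ)) -
          anchorScale P i₀ (recentre S t (clampedRatio P i₀ ε₀ θ₀ t S)) * ustar i (-(P.K : ℤ))| ≤ P.δ (n + 1))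
    (hle : δs (n + 1) ≤ P.δ (n + 1)) :
    TubeStepCoreWith P Bcl (choiceRule P i₀ ε₀ θ₀ t₀ good) 𝕊 ε₀ i₀ α X₀ w r c₀ ζ ustar n :=
  tubeStepCoreWith_of_good hex fun z S₀ τ S F hprem t ht =>
    coreClause_of_from_of_row P (hfrom z S₀ τ S F hprem t ht) (hrow z S₀ τ S F hprem t ht) hle

/-- **The sharp rows of `H(n)` from the split slot** (what `interfaceStart_le_of_clauses` and the E2 start box read): a premise of the
re-instanced tube carries `CoreClauseFrom P δs i₀ u⋆ n z` in its slot. [folklore (definitional); cell LADDER §64.2] -/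
theorem coreClauseFrom_of_splitBcl {P : TubeSchedule} {Bcl : ℕ → (Fin 2 → ℤ → ℝ) → Prop} {δs : ℕ → ℝ} {i₀ : Fin 2}
    {ustar : Fin 2 → ℤ → ℝ} {n : ℕ} {z : Fin 2 → ℤ → ℝ} (h : splitBcl P Bcl δs i₀ ustar n z) :
    CoreClauseFrom P δs i₀ ustar n z := h.2

end StepZ

end Summit.NavierStokesRegularity.NavierStokesRegularity.Theorems.HopTube

end
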